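import Summits.HodgeConjecture.CorCM.DihedralReflexPairCMHodge
import Summits.HodgeConjecture.CorCM.ImaginaryQuadraticTimesSimpleCMSurfaceHodge
import HarnessLib

/-!
# Two slots with ISOMORPHIC quartic CM fields: the dihedral `K`–`K` pair is nondegenerate when separating; the cyclic
# `K`–`K` pair is never separating

COR-CM (cell `pub-hodgecm2`, seat p2 gen 18, count-neutral claim CLOSURE-BOUND (F6b)); NEW as stated, hence under
`Summits/`.  Theorems only; no definition, no named fact, no `sorry`.  Second case file (after `DihedralReflexPairCMHodge`,
the `K`–`M` pair) for `TwoSimpleCMSurfacesHodge` (ANY two simple CM abelian surfaces form a nondegenerate pair).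

THE SITUATION.  A two-slot family `(K_{i₀}, Φ₀), (K_{i₁}, Φ₁)` of quartic CM fields with `K_{i₁} ≅ K_{i₀}` (a ring
isomorphism `e`), read through `e`: the embeddings of `K_{i₁}` are the `s ∘ e`, `s ∈ Hom(K_{i₀}, ℂ) = {a, ā, b, b̄}`, and
`Φ₁ ∘ e⁻¹` is one of the four types `{a,b}, {a,b̄}, {ā,b}, {ā,b̄}` of `K_{i₀}`.
* `K_{i₀}` NOT Galois (dihedral).  If the family is SEPARATING (the two simple CM surfaces are not isogenous:
  `Φ₁ ∘ e⁻¹ ∉ {Φ₀, Φ̄₀}`), the swap `g` of `a, b` (`DihedralReflexSwapReflect`, `g = τσ₀`) stabilises `Φ₀ = {a, b}` and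
  MOVES `Φ₁` (`Φ₁ ∘ e⁻¹ ∈ {{a, b̄}, {ā, b}}` are exchanged by `g`), and `U(Φ₁)` is irreducible: STABILISER SEPARATION
  (`CMTypeRankTypeConjugation` §2) gives nondegeneracy — **`isNondegenerateFamily_of_ringEquiv_of_not_isGalois`**.
  This re-proves seat b24's `QuarticCMTypePairNondegenerate` (there: one field, `Pohlmann1968.IsNondegenerateFamily ![Φ, Ψ]`,
  by Pohlmann weights) for heterogeneous two-slot families `CMAlgebra.IsNondegenerateFamily`, structurally.
* `K_{i₀}` Galois with CYCLIC group.  Then NO two-slot family is separating — **`not_isSeparatingFamily_of_ringEquiv_of_isCyclic`**: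
  `Aut(ℂ)` acts on `Hom(K_{i₀}, ℂ) = {a ∘ w}` through `Gal(K_{i₀}/ℚ) = ⟨r⟩ ≅ C₄`, a type is a coset pattern `{w, rw}·v`, and all
  four types are translates of each other, so some embedding of `K_{i₀}` and some embedding of `K_{i₁}` have the same
  pattern of translates (the two simple CM surfaces are isogenous: Shimura §8.4 (2)(B)).
* `isNondegenerateFamily_of_swap_of_moves` — the common engine (F4b's `isNondegenerateFamily_of_swap_reflect` with the
  conclusion of the reflection replaced by its use: `g` moves `Φ_{i₁}`).

## References

* [Shimura1998] G. Shimura, *Abelian Varieties with Complex Multiplication and Modular Functions*, §8.4 Example (2)(B), (C).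
* [MoonenZarhin1999LowDim] B. Moonen, Yu. Zarhin, *Hodge classes on abelian varieties of low dimension*, Math. Ann. 315
  (1999), "Hodge groups of simple abelian surfaces of CM-type".
* [Gordon1999HodgeAVSurvey] B. B. Gordon, *A survey of the Hodge conjecture for abelian varieties*, 7.4–7.5.
-/

noncomputable section

open CategoryTheory CategoryTheory.Limits NumberField NumberField.ComplexEmbedding IntermediateField
open scoped BigOperators

namespace Summit.HodgeConjecture.CorCM

open Literature.NumberTheory.ComplexMultiplication
open Literature.NumberTheory.ComplexMultiplication.CMTypeOps (mem_iff_conjugate_notMem conjugate_mem_iff_notMem)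
open Literature.AlgebraicGeometry.Motives (CMType)
open Literature.AlgebraicGeometry.Pohlmann1968
open Summit.HodgeConjecture.CorCM.CyclicSextic (conjugate_eq_comp_conjGal)
open QuarticCM

namespace QuarticCMPairs

/-! ### §1 Embeddings through a field isomorphism -/

section Iso

variable {K M : Type} [Field K] [NumberField K] [IsCMField K] [Field M] [NumberField M] [IsCMField M]

omit [IsCMField K] [IsCMField M] in
/-- A ring homomorphism between number fields of the same degree is bijective. [folklore] -/
theorem bijective_of_finrank_eq (h : Module.finrank ℚ M = Module.finrank ℚ K) (e : M →+* K) : Function.Bijective e :=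
  ⟨e.injective, (LinearMap.injective_iff_surjective_of_finrank_eq_finrank h (f := e.toRatAlgHom.toLinearMap)).1
    e.injective⟩

omit [NumberField K] [IsCMField K] [NumberField M] [IsCMField M] in
/-- `τ ∘ (s ∘ e) = (τ ∘ s) ∘ e`. [folklore] -/
theorem smul_comp_ringEquiv (τ : ℂ ≃+* ℂ) (s : K →+* ℂ) (e : M ≃+* K) :
    τ • s.comp e.toRingHom = (τ • s).comp e.toRingHom :=
  RingHom.ext fun _ => rfl

omit [NumberField K] [NumberField M] in
/-- `\overline{s ∘ e} = s̄ ∘ e`. [folklore] -/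
theorem conjugate_comp_ringEquiv (s : K →+* ℂ) (e : M ≃+* K) :
    conjugate (s.comp e.toRingHom) = (conjugate s).comp e.toRingHom :=
  RingHom.ext fun _ => rfl

omit [NumberField K] [IsCMField K] [NumberField M] [IsCMField M] in
/-- `s ↦ s ∘ e` is injective for an isomorphism `e`. [folklore] -/
theorem comp_ringEquiv_injective (e : M ≃+* K) : Function.Injective fun s : K →+* ℂ => s.comp e.toRingHom := by
  intro s t hst
  refine RingHom.ext fun x => ?_
  have := RingHom.congr_fun hst (e.symm x)
  simpa using this

omit [NumberField K] [IsCMField K] [NumberField M] [IsCMField M] in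
/-- Every embedding of `M` is `s ∘ e` for an embedding `s` of `K ≅ M`. [folklore] -/
theorem exists_eq_comp_ringEquiv (e : M ≃+* K) (t : M →+* ℂ) : ∃ s : K →+* ℂ, t = s.comp e.toRingHom :=
  ⟨t.comp e.symm.toRingHom, RingHom.ext fun y => by simp⟩

end Iso

/-! ### §2 The engine: a swap of `Φ_{i₀} = {a, b}` moving `Φ_{i₁}` -/

section Family

variable {I : Type} {K : I → Type} [∀ i, Field (K i)] [∀ i, NumberField (K i)] [∀ i, IsCMField (K i)] [Fintype I]
  [DecidableEq I]

omit [∀ i, IsCMField (K i)] [DecidableEq I] in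
/-- `|⊔_i Hom(K_i, ℂ)| = Σ_i [K_i : ℚ]`. [folklore] -/
private theorem card_sigma_ringHom_eq_sum₄ :
    Fintype.card ((i : I) × (K i →+* ℂ)) = ∑ i, Module.finrank ℚ (K i) := by
  rw [Fintype.card_sigma]
  exact Finset.sum_congr rfl fun i _ => Embeddings.card (K i) ℂ

/-- **Stabiliser separation for two quartic slots** (engine): `K_{i₀}, K_{i₁}` non-Galois quartic CM fields,
`Φ_{i₀} = {a, b}`, `g ∈ Aut(ℂ)` swapping `a, b` and MOVING `Φ_{i₁}` (`g⁻¹Φ_{i₁} ≠ Φ_{i₁}`) ⟹ the two-slot family is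
nondegenerate (`CMTypeRankTypeConjugation` §2 with `DihedralReflexSwapReflect.antiSpan_eq_of_stable`).
[cite: MoonenZarhin1999LowDim, "Hodge groups of simple abelian surfaces of CM-type"] [cite: Gordon1999HodgeAVSurvey, 7.5] -/
theorem isNondegenerateFamily_of_swap_of_moves {i₀ i₁ : I} (hI : ∀ j, j = i₀ ∨ j = i₁) (h01 : i₀ ≠ i₁)
    (h4₀ : Module.finrank ℚ (K i₀) = 4) (hK₀ : ¬IsGalois ℚ (K i₀)) (h4₁ : Module.finrank ℚ (K i₁) = 4)
    (hK₁ : ¬IsGalois ℚ (K i₁)) (Φ : ∀ i, CMType (K i)) {a b : K i₀ →+* ℂ} (hba : b ≠ a) (hba' : b ≠ conjugate a)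
    (hΦ : ∀ s, s ∈ (Φ i₀).1 ↔ s = a ∨ s = b) {g : ℂ ≃+* ℂ} (hga : g • a = b) (hgb : g • b = a)
    (hmove : ∃ y : K i₁ →+* ℂ, ¬(g • y ∈ (Φ i₁).1 ↔ y ∈ (Φ i₁).1)) : CMAlgebra.IsNondegenerateFamily Φ := by
  haveI : Nonempty I := ⟨i₁⟩
  have ha : a ∈ (Φ i₀).1 := (hΦ a).2 (Or.inl rfl)
  have hb : b ∈ (Φ i₀).1 := (hΦ b).2 (Or.inr rfl)
  have hna : conjugate a ∉ (Φ i₀).1 := (mem_iff_conjugate_notMem _ a).1 ha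
  have hnb : conjugate b ∉ (Φ i₀).1 := (mem_iff_conjugate_notMem _ b).1 hb
  have hstab : ∀ i, i ≠ i₁ → ∀ y : K i →+* ℂ, g • y ∈ (Φ i).1 ↔ y ∈ (Φ i).1 := by
    intro i hi y
    obtain rfl : i = i₀ := (hI i).resolve_right hi
    rcases eq_or_eq_or_eq_or_eq h4₀ hba hba' y with rfl | rfl | rfl | rfl
    · rw [hga]; exact iff_of_true hb ha
    · rw [smul_conjugate, hga]; exact iff_of_false hnb hna
    · rw [hgb]; exact iff_of_true ha hb
    · rw [smul_conjugate, hgb]; exact iff_of_false hna hnb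
  have key := typeRank_sigmaType_eq_iff_forall_of_stabSep_pair (G := ℂ ≃+* ℂ) (Φ := fun i => (Φ i).1) i₁
    (fun i => isCMTypeWith_conj (Φ i)) hI h01 hstab hmove (DihedralReflexPair.antiSpan_eq_of_stable h4₁ hK₁ (Φ i₁))
  rw [CMAlgebra.isNondegenerateFamily_iff, ← card_sigma_ringHom_eq_sum₄ (K := K)]
  refine key.2 fun i => ?_
  have hnd : IsNondegenerate (Φ i) := by
    rcases hI i with rfl | rfl
    · exact isNondegenerate_of_not_isGalois h4₀ hK₀ (Φ _)
    · exact isNondegenerate_of_not_isGalois h4₁ hK₁ (Φ _)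
  rw [isNondegenerate_iff, cmTypeRank, ← Embeddings.card (K i) ℂ] at hnd
  exact hnd

/-! ### §3 The dihedral `K`–`K` pair -/

omit [Fintype I] [DecidableEq I] in
/-- **Separating ⟹ `Φ_{i₁} ∘ e⁻¹ ∉ {Φ₀, Φ̄₀}`**: if `Φ_{i₁}` contained `a ∘ e` and `b ∘ e` (resp. `ā ∘ e` and `b̄ ∘ e`) then
the embeddings `a` of `K_{i₀}` and `a ∘ e` (resp. `ā ∘ e`) of `K_{i₁}` would have the same pattern of translates — the two
members would be CM-equivalent (isogenous abelian surfaces), against separation. [cite: Gordon1999HodgeAVSurvey, 7.4] -/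
theorem not_mem_and_mem_of_isSeparatingFamily {i₀ i₁ : I} (h01 : i₀ ≠ i₁) (h4₀ : Module.finrank ℚ (K i₀) = 4)
    (e : K i₁ ≃+* K i₀) {Φ : ∀ i, CMType (K i)} (hsep : CMAlgebra.IsSeparatingFamily Φ) {a b : K i₀ →+* ℂ}
    (hba : b ≠ a) (hba' : b ≠ conjugate a) (hΦ : ∀ s, s ∈ (Φ i₀).1 ↔ s = a ∨ s = b) :
    ¬(a.comp e.toRingHom ∈ (Φ i₁).1 ∧ b.comp e.toRingHom ∈ (Φ i₁).1) ∧
      ¬((conjugate a).comp e.toRingHom ∈ (Φ i₁).1 ∧ (conjugate b).comp e.toRingHom ∈ (Φ i₁).1) := by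
  have ha : a ∈ (Φ i₀).1 := (hΦ a).2 (Or.inl rfl)
  have hb : b ∈ (Φ i₀).1 := (hΦ b).2 (Or.inr rfl)
  have hna : conjugate a ∉ (Φ i₀).1 := (mem_iff_conjugate_notMem _ a).1 ha
  have hnb : conjugate b ∉ (Φ i₀).1 := (mem_iff_conjugate_notMem _ b).1 hb
  rw [CMAlgebra.isSeparatingFamily_iff_smul] at hsep
  constructor
  · rintro ⟨hae, hbe⟩
    have hnae : (conjugate a).comp e.toRingHom ∉ (Φ i₁).1 := by
      rw [← conjugate_comp_ringEquiv]; exact (mem_iff_conjugate_notMem _ _).1 hae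
    have hnbe : (conjugate b).comp e.toRingHom ∉ (Φ i₁).1 := by
      rw [← conjugate_comp_ringEquiv]; exact (mem_iff_conjugate_notMem _ _).1 hbe
    have := hsep ⟨i₀, a⟩ ⟨i₁, a.comp e.toRingHom⟩ fun τ => by
      rw [CMAlgebra.smul_sigma_mk, CMAlgebra.smul_sigma_mk, CMAlgebra.mem_familyType_iff,
        CMAlgebra.mem_familyType_iff, smul_comp_ringEquiv]
      change τ • a ∈ (Φ i₀).1 ↔ (τ • a).comp e.toRingHom ∈ (Φ i₁).1
      rcases eq_or_eq_or_eq_or_eq h4₀ hba hba' (τ • a) with h | h | h | h <;> rw [h]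
      · exact iff_of_true ha hae
      · exact iff_of_false hna hnae
      · exact iff_of_true hb hbe
      · exact iff_of_false hnb hnbe
    exact h01 (congrArg Sigma.fst this)
  · rintro ⟨hae, hbe⟩
    have hnae : a.comp e.toRingHom ∉ (Φ i₁).1 := fun h =>
      (mem_iff_conjugate_notMem _ _).1 h (by rw [conjugate_comp_ringEquiv]; exact hae)
    have hnbe : b.comp e.toRingHom ∉ (Φ i₁).1 := fun h =>
      (mem_iff_conjugate_notMem _ _).1 h (by rw [conjugate_comp_ringEquiv]; exact hbe)
    have := hsep ⟨i₀, a⟩ ⟨i₁, (conjugate a).comp e.toRingHom⟩ fun τ => by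
      rw [CMAlgebra.smul_sigma_mk, CMAlgebra.smul_sigma_mk, CMAlgebra.mem_familyType_iff,
        CMAlgebra.mem_familyType_iff, smul_comp_ringEquiv, smul_conjugate]
      change τ • a ∈ (Φ i₀).1 ↔ (conjugate (τ • a)).comp e.toRingHom ∈ (Φ i₁).1
      rcases eq_or_eq_or_eq_or_eq h4₀ hba hba' (τ • a) with h | h | h | h <;> rw [h]
      · exact iff_of_true ha hae
      · rw [involutive_conjugate]; exact iff_of_false hna hnae
      · exact iff_of_true hb hbe
      · rw [involutive_conjugate]; exact iff_of_false hnb hnbe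
    exact h01 (congrArg Sigma.fst this)

/-- **The dihedral `K`–`K` pair: separating ⟹ nondegenerate.**  `K_{i₀}` a NON-GALOIS quartic CM field, `K_{i₁} ≅ K_{i₀}`
(`e`); every SEPARATING two-slot family of CM types (the two simple CM abelian surfaces are not isogenous) is nondegenerate:
`Φ_{i₁} ∘ e⁻¹ ∈ {{a, b̄}, {ā, b}}` is moved by the swap `g` of `a ↔ b` (`g = τσ₀`), which stabilises `Φ₀ = {a, b}`
(engine §2).  Heterogeneous form of seat b24's `QuarticCMTypePairNondegenerate`, by stabiliser separation instead of
Pohlmann weights. [cite: MoonenZarhin1999LowDim, "Hodge groups of simple abelian surfaces of CM-type"] -/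
theorem isNondegenerateFamily_of_ringEquiv_of_not_isGalois {i₀ i₁ : I} (hI : ∀ j, j = i₀ ∨ j = i₁) (h01 : i₀ ≠ i₁)
    (h4₀ : Module.finrank ℚ (K i₀) = 4) (hK₀ : ¬IsGalois ℚ (K i₀)) (e : K i₁ ≃+* K i₀) (Φ : ∀ i, CMType (K i))
    (hsep : CMAlgebra.IsSeparatingFamily Φ) : CMAlgebra.IsNondegenerateFamily Φ := by
  let eₐ : K i₁ ≃ₐ[ℚ] K i₀ := AlgEquiv.ofRingEquiv (f := e) fun q => by simp
  have h4₁ : Module.finrank ℚ (K i₁) = 4 := by rw [← h4₀]; exact eₐ.toLinearEquiv.finrank_eq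
  have hK₁ : ¬IsGalois ℚ (K i₁) := fun h => hK₀ (IsGalois.of_algEquiv eₐ)
  obtain ⟨a, b, hba, hba', hΦ⟩ := exists_mem_mem_ne h4₀ (Φ i₀)
  -- the swap `g = τσ₀`
  obtain ⟨τ, hτa, hτb⟩ := exists_ringAut_smul_eq_smul_eq_conjugate h4₀ hK₀ hba hba'
  obtain ⟨σ₀, hσa, hσb⟩ := exists_ringAut_smul_eq_self_smul_eq_conjugate_of_not_isGalois h4₀ hK₀ hba hba'
  have hga : (τ * σ₀) • a = b := by rw [mul_smul, hσa, hτa]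
  have hgb : (τ * σ₀) • b = a := by rw [mul_smul, hσb, smul_conjugate, hτb, involutive_conjugate]
  -- `Φ_{i₁}` through `e`
  obtain ⟨h1, h2⟩ := not_mem_and_mem_of_isSeparatingFamily h01 h4₀ e hsep hba hba' hΦ
  refine isNondegenerateFamily_of_swap_of_moves hI h01 h4₀ hK₀ h4₁ hK₁ Φ hba hba' hΦ hga hgb ?_
  by_cases hae : a.comp e.toRingHom ∈ (Φ i₁).1
  · -- then `b ∘ e ∉ Φ₁`: `g` sends `a ∘ e ∈ Φ₁` to `b ∘ e ∉ Φ₁`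
    have hbe : b.comp e.toRingHom ∉ (Φ i₁).1 := fun h => h1 ⟨hae, h⟩
    exact ⟨a.comp e.toRingHom, fun h => hbe (by rw [smul_comp_ringEquiv, hga] at h; exact h.2 hae)⟩
  · by_cases hbe : b.comp e.toRingHom ∈ (Φ i₁).1
    · -- `g` sends `b ∘ e ∈ Φ₁` to `a ∘ e ∉ Φ₁`
      exact ⟨b.comp e.toRingHom, fun h => hae (by rw [smul_comp_ringEquiv, hgb] at h; exact h.2 hbe)⟩
    · -- `ā ∘ e, b̄ ∘ e ∈ Φ₁`: excluded by separation
      exfalso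
      refine h2 ⟨?_, ?_⟩
      · rw [← conjugate_comp_ringEquiv]; exact (conjugate_mem_iff_notMem _ _).2 hae
      · rw [← conjugate_comp_ringEquiv]; exact (conjugate_mem_iff_notMem _ _).2 hbe

end Family

/-! ### §4 The cyclic `K`–`K` pair is never separating -/

section Cyclic

variable {I : Type} {K : I → Type} [∀ i, Field (K i)] [∀ i, NumberField (K i)] [∀ i, IsCMField (K i)]

/-- **Two slots with isomorphic CYCLIC quartic CM fields are never separating** (the two simple CM surfaces are
isogenous): `Aut(ℂ)` acts on `Hom(K_{i₀}, ℂ) = {a ∘ w | w ∈ ⟨r⟩}` by `w ↦ w_τ w`, a CM type is a set `{w, rw}·v`, all four are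
translates of one another, so `a` and a suitable embedding `(a ∘ v) ∘ e` of `K_{i₁}` have the same pattern of translates.
[cite: Shimura1998, §8.4 Example (2)(B)] [cite: Gordon1999HodgeAVSurvey, 7.4] -/
theorem not_isSeparatingFamily_of_ringEquiv_of_isCyclic {i₀ i₁ : I} (h01 : i₀ ≠ i₁) [IsGalois ℚ (K i₀)]
    (h4₀ : Module.finrank ℚ (K i₀) = 4) (hcyc : IsCyclic (K i₀ ≃ₐ[ℚ] K i₀)) (e : K i₁ ≃+* K i₀)
    (Φ : ∀ i, CMType (K i)) : ¬CMAlgebra.IsSeparatingFamily Φ := by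
  classical
  intro hsep
  rw [CMAlgebra.isSeparatingFamily_iff_smul] at hsep
  obtain ⟨a⟩ : Nonempty (K i₀ →+* ℂ) := inferInstance
  -- notation: `emb w = a ∘ w`
  let emb : (K i₀ ≃ₐ[ℚ] K i₀) → (K i₀ →+* ℂ) := fun w => a.comp w.toRingEquiv.toRingHom
  have hemb : ∀ w, emb w = a.comp w.toRingEquiv.toRingHom := fun _ => rfl
  -- a generator `r` with `r² = c`
  obtain ⟨r, hr⟩ := IsCyclic.exists_generator (α := K i₀ ≃ₐ[ℚ] K i₀)
  have hord : orderOf r = 4 := by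
    rw [orderOf_eq_card_of_forall_mem_zpowers hr, IsGalois.card_aut_eq_finrank, h4₀]
  have hr1 : r ≠ 1 := fun h => by rw [h, orderOf_one] at hord; exact absurd hord (by norm_num)
  have hrc : r ≠ conjGal := fun h => by
    have : orderOf r = 2 := by rw [h]; exact CyclicSextic.orderOf_conjGal
    rw [this] at hord; exact absurd hord (by norm_num)
  have hrr : r * r = conjGal := mul_self_eq_conjGal_of_isCyclic h4₀ hcyc hr1 hrc
  have hcc : (conjGal : K i₀ ≃ₐ[ℚ] K i₀) * conjGal = 1 := conjGal_mul_conjGal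
  have hmem : ∀ x : K i₀ ≃ₐ[ℚ] K i₀, x = 1 ∨ x = r ∨ x = conjGal ∨ x = r * conjGal := fun x => by
    have hx := (mem_zpowers_iff_mem_range_orderOf (x := r) (y := x)).1 (hr x)
    rw [hord] at hx
    simp only [Finset.mem_image, Finset.mem_range] at hx
    obtain ⟨k, hk, rfl⟩ := hx
    interval_cases k
    · exact Or.inl (pow_zero r)
    · exact Or.inr (Or.inl (pow_one r))
    · exact Or.inr (Or.inr (Or.inl (by rw [pow_two, hrr])))
    · exact Or.inr (Or.inr (Or.inr (by rw [pow_succ, pow_two, hrr, (commute_conjGal r).eq])))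
  -- conjugation = multiplication by `c`
  have hconj₀ : ∀ w, emb (w * conjGal) ∈ (Φ i₀).1 ↔ emb w ∉ (Φ i₀).1 := fun w => by
    rw [hemb, hemb, ← comp_algEquiv_comp, ← conjugate_eq_comp_conjGal]
    exact conjugate_mem_iff_notMem _ _
  have hconj₁ : ∀ w, (emb (w * conjGal)).comp e.toRingHom ∈ (Φ i₁).1 ↔ (emb w).comp e.toRingHom ∉ (Φ i₁).1 :=
      fun w => by
    rw [hemb, hemb, ← comp_algEquiv_comp, ← conjugate_eq_comp_conjGal, ← conjugate_comp_ringEquiv]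
    exact conjugate_mem_iff_notMem _ _
  -- the translate `v`: `(1 ∈ S₀ ↔ v ∈ S₁) ∧ (r ∈ S₀ ↔ rv ∈ S₁)`
  have key : ∃ v : K i₀ ≃ₐ[ℚ] K i₀, (emb 1 ∈ (Φ i₀).1 ↔ (emb v).comp e.toRingHom ∈ (Φ i₁).1) ∧
      (emb r ∈ (Φ i₀).1 ↔ (emb (r * v)).comp e.toRingHom ∈ (Φ i₁).1) := by
    have e1c : (1 : K i₀ ≃ₐ[ℚ] K i₀) * conjGal = conjGal := one_mul _
    have erc' : r * (r * conjGal) = conjGal * conjGal := by rw [← mul_assoc, hrr]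
    have hc1 : (emb conjGal).comp e.toRingHom ∈ (Φ i₁).1 ↔ (emb 1).comp e.toRingHom ∉ (Φ i₁).1 := by
      rw [← e1c]; exact hconj₁ 1
    have hrc1 : (emb (r * conjGal)).comp e.toRingHom ∈ (Φ i₁).1 ↔ (emb r).comp e.toRingHom ∉ (Φ i₁).1 :=
      hconj₁ r
    have hrrv : (emb (r * r)).comp e.toRingHom ∈ (Φ i₁).1 ↔ (emb 1).comp e.toRingHom ∉ (Φ i₁).1 := by
      rw [hrr]; exact hc1
    have hrrc : (emb (r * (r * conjGal))).comp e.toRingHom ∈ (Φ i₁).1 ↔ (emb 1).comp e.toRingHom ∈ (Φ i₁).1 := by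
      rw [erc', hcc]
    by_cases A' : (emb 1).comp e.toRingHom ∈ (Φ i₁).1 <;> by_cases B' : (emb r).comp e.toRingHom ∈ (Φ i₁).1 <;>
      by_cases A : emb 1 ∈ (Φ i₀).1 <;> by_cases B : emb r ∈ (Φ i₀).1
    all_goals first
      | exact ⟨1, by rw [mul_one]; exact ⟨iff_of_true A A' , iff_of_true B B'⟩⟩
      | exact ⟨1, by rw [mul_one]; exact ⟨iff_of_true A A', iff_of_false B B'⟩⟩
      | exact ⟨1, by rw [mul_one]; exact ⟨iff_of_false A A', iff_of_true B B'⟩⟩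
      | exact ⟨1, by rw [mul_one]; exact ⟨iff_of_false A A', iff_of_false B B'⟩⟩
      | exact ⟨r, ⟨iff_of_true A B', by rw [hrrv]; exact iff_of_true B A'⟩⟩
      | exact ⟨r, ⟨iff_of_true A B', by rw [hrrv]; exact iff_of_false B (not_not.2 A')⟩⟩
      | exact ⟨r, ⟨iff_of_false A B', by rw [hrrv]; exact iff_of_true B A'⟩⟩
      | exact ⟨r, ⟨iff_of_false A B', by rw [hrrv]; exact iff_of_false B (not_not.2 A')⟩⟩
      | exact ⟨conjGal, ⟨by rw [hc1]; exact iff_of_true A A', by rw [hrc1]; exact iff_of_true B B'⟩⟩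
      | exact ⟨conjGal, ⟨by rw [hc1]; exact iff_of_true A A', by rw [hrc1]; exact iff_of_false B (not_not.2 B')⟩⟩
      | exact ⟨conjGal, ⟨by rw [hc1]; exact iff_of_false A (not_not.2 A'), by rw [hrc1]; exact iff_of_true B B'⟩⟩
      | exact ⟨conjGal, ⟨by rw [hc1]; exact iff_of_false A (not_not.2 A'),
          by rw [hrc1]; exact iff_of_false B (not_not.2 B')⟩⟩
      | exact ⟨r * conjGal, ⟨by rw [hrc1]; exact iff_of_true A B', by rw [hrrc]; exact iff_of_true B A'⟩⟩
      | exact ⟨r * conjGal, ⟨by rw [hrc1]; exact iff_of_true A B', by rw [hrrc]; exact iff_of_false B A'⟩⟩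
      | exact ⟨r * conjGal, ⟨by rw [hrc1]; exact iff_of_false A (not_not.2 B'), by rw [hrrc]; exact iff_of_true B A'⟩⟩
      | exact ⟨r * conjGal, ⟨by rw [hrc1]; exact iff_of_false A (not_not.2 B'), by rw [hrrc]; exact iff_of_false B A'⟩⟩
  obtain ⟨v, hv1, hvr⟩ := key
  -- extend to all four `w`
  have hall : ∀ w, emb w ∈ (Φ i₀).1 ↔ (emb (w * v)).comp e.toRingHom ∈ (Φ i₁).1 := by
    intro w
    rcases hmem w with rfl | rfl | rfl | rfl
    · rw [one_mul]; exact hv1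
    · exact hvr
    · have e1 : emb conjGal = emb (1 * conjGal) := by rw [one_mul]
      have e2 : (conjGal : K i₀ ≃ₐ[ℚ] K i₀) * v = v * conjGal := (commute_conjGal v).eq
      rw [e1, hconj₀, e2, hconj₁]
      exact not_congr hv1
    · have e3 : r * conjGal * v = r * v * conjGal := by rw [mul_assoc, (commute_conjGal v).eq, ← mul_assoc]
      rw [hconj₀, e3, hconj₁]
      exact not_congr hvr
  -- the witness: `a` and `(a ∘ v) ∘ e` have the same pattern
  have := hsep ⟨i₀, a⟩ ⟨i₁, (emb v).comp e.toRingHom⟩ fun τ => by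
    obtain ⟨w, hw⟩ := exists_eq_comp_algEquiv a (τ • a)
    rw [CMAlgebra.smul_sigma_mk, CMAlgebra.smul_sigma_mk, CMAlgebra.mem_familyType_iff,
      CMAlgebra.mem_familyType_iff, smul_comp_ringEquiv, hemb, smul_comp_algEquiv, hw, comp_algEquiv_comp]
    change emb w ∈ (Φ i₀).1 ↔ (emb (w * v)).comp e.toRingHom ∈ (Φ i₁).1
    exact hall w
  exact h01 (congrArg Sigma.fst this)

end Cyclic

end QuarticCMPairs

end Summit.HodgeConjecture.CorCM

end
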